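import Literature.Geometry.Symplectic.SteinJBundle
import Literature.Geometry.Symplectic.SteinBoundaryContactProofs
import Literature.Geometry.Kaehler.ManifoldFormsChart
import Mathlib.Analysis.Calculus.ContDiff.FiniteDimension
import HarnessLib

/-!
# From Stein to Liouville: smoothness of `d^ℂφ` and the Liouville domain of a Stein domain

Topic `Literature/Geometry/Symplectic`.  `SteinDomain.lean` defines Stein domains
(`SteinStructure W`: integrable `J`, `J`-convex `φ` with `∂W` its regular maximal level set) and
Liouville domains (`IsLiouvilleDomain W lam`: `lam` smooth, `d lam` non-degenerate, Liouville
field outward pointing along `∂W`), and records the bridge *"for a Stein domain,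
`λ = -dφ ∘ J` is such a Liouville form ('from Stein to Weinstein')"* only in prose.  This file
**proves** it:

* `continuous_mfderiv_tangentBundle` — for a `C¹` function `f : W → ℝ`, `(x, v) ↦ df_x(v)` is
  continuous on `TW` (Mathlib's `tangentMap`); hence the contact form `α = -dφ ∘ J` of a Stein
  structure is continuous on `TW` (`SteinStructure.continuous_contactForm_bundle`, with
  `continuous_Jbundle` of `SteinJBundle.lean`);
* `isSmoothForm_dComplex_of_preservesSmoothFields` / `SteinStructure.isSmoothForm_dComplex` —
  **the 1-form `d^ℂφ = dφ ∘ J` is a smooth form** (`Literature.Geometry.Kaehler.IsSmoothForm`):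
  in the chart at `x₀` its representative is `y ↦ D(φ ∘ c⁻¹)_y ∘ Ĵ_y` (`inChart_dComplex_apply`)
  with `Ĵ` the matrix of `J` in the trivialization at `x₀` (`JTriv`, smooth by
  `contMDiffAt_JTriv`);
* `SteinStructure.isSmoothForm_kahler` — so `ω = -dd^ℂφ` is a smooth 2-form
  (`isSmoothForm_mextDeriv` and the discharged `inChart_mextDeriv_holds`);
* `SteinStructure.isLiouvilleDomain` — **a Stein domain is a Liouville domain for
  `λ = -d^ℂφ`**: `dλ = ω` is non-degenerate since `ω(v, Jv) > 0` (`J`-convexity), and the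
  Liouville field `Z` (`ι_Z ω = λ`) points out along `∂W`: `dφ(Z) = ω(Z, JZ) > 0`, while `dφ_x`
  is a *negative* multiple of the inward coordinate `v ↦ v 0` at a boundary point (`φ` attains
  its maximum on `∂W`: one-sided Fermat `IsLocalMaxOn.fderivWithin_nonpos`, and `dφ_x ≠ 0`).

## References

* K. Cieliebak, Ya. Eliashberg, *From Stein to Weinstein and back*, AMS Coll. Publ. 59 (2012),
  §2 (J-convex functions: `-dd^ℂφ(v, Jv) > 0`), §11.1 (Liouville domains), and the
  introduction ("from Stein to Weinstein"). [CieliebakEliashberg2012]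
* Ya. Eliashberg, *Topological characterization of Stein manifolds of dimension > 2*,
  Internat. J. Math. 1 (1990), §1. [Eliashberg1990Stein]
-/

noncomputable section

open scoped Manifold ContDiff Topology Bundle
open Set Function Bundle Filter

namespace Literature.Geometry.Symplectic

open Literature.Geometry.Kaehler

/-- The model vector space `ℝ⁴` of the tangent spaces. [folklore] -/
local notation "E4" => EuclideanSpace ℝ (Fin 4)

variable {W : Type*} [TopologicalSpace W] [ChartedSpace (EuclideanHalfSpace 4) W]
  [IsManifold (𝓡∂ 4) ∞ W]

/-! ### `df` is continuous on the tangent bundle -/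

/-- **`(x, v) ↦ df_x(v)` is continuous on `TW`** for a `C¹` function `f : W → ℝ` (the second
component of Mathlib's continuous `tangentMap`). [folklore] -/
theorem continuous_mfderiv_tangentBundle {f : W → ℝ} (hf : ContMDiff (𝓡∂ 4) 𝓘(ℝ, ℝ) 1 f) :
    Continuous fun p : TangentBundle (𝓡∂ 4) W => mfderiv (𝓡∂ 4) 𝓘(ℝ, ℝ) f p.proj p.2 := by
  have h1 : Continuous (tangentMap (𝓡∂ 4) 𝓘(ℝ, ℝ) f) := hf.continuous_tangentMap le_rfl
  have h2 := (contMDiff_snd_tangentBundle_modelSpace (n := ∞) ℝ 𝓘(ℝ, ℝ)).continuous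
  exact h2.comp h1

/-- Parametrised form: along a continuous family of tangent vectors `q ↦ (x q, v q)`,
`q ↦ df_{x q}(v q)` is continuous (within a set). [folklore] -/
theorem ContinuousWithinAt.mfderiv_apply {f : W → ℝ} (hf : ContMDiff (𝓡∂ 4) 𝓘(ℝ, ℝ) 1 f)
    {P : Type*} [TopologicalSpace P] {x : P → W} {v : P → E4} {s : Set P} {q₀ : P}
    (h : ContinuousWithinAt (fun q => (TotalSpace.mk' E4 (x q) (v q) : TangentBundle (𝓡∂ 4) W)) s q₀) :
    ContinuousWithinAt (fun q => mfderiv (𝓡∂ 4) 𝓘(ℝ, ℝ) f (x q) (v q)) s q₀ :=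
  (continuous_mfderiv_tangentBundle hf).continuousAt.comp_continuousWithinAt h

variable [CompactSpace W]

namespace SteinStructure

/-- `(x, v) ↦ dφ_x(v)` is continuous on `TW`. [folklore] -/
theorem continuous_dφ_bundle (S : SteinStructure W) :
    Continuous fun p : TangentBundle (𝓡∂ 4) W => S.dφ p.proj p.2 :=
  continuous_mfderiv_tangentBundle (S.φ_smooth.of_le (by simp))

/-- **The contact form is continuous on `TW`**: `(x, v) ↦ α_x(v) = -dφ_x(J_x v)`
(`continuous_Jbundle`). [folklore] -/
theorem continuous_contactForm_bundle [T2Space W] (S : SteinStructure W) :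
    Continuous fun p : TangentBundle (𝓡∂ 4) W => S.contactForm p.proj p.2 := by
  have h := (S.continuous_dφ_bundle.comp (continuous_Jbundle S.preservesSmoothFields)).neg
  exact h.congr fun p => rfl

/-- Parametrised form of `continuous_contactForm_bundle`. [folklore] -/
theorem _root_.ContinuousWithinAt.contactForm_apply [T2Space W] (S : SteinStructure W)
    {P : Type*} [TopologicalSpace P] {x : P → W} {v : P → E4} {s : Set P} {q₀ : P}
    (h : ContinuousWithinAt (fun q => (TotalSpace.mk' E4 (x q) (v q) : TangentBundle (𝓡∂ 4) W)) s q₀) :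
    ContinuousWithinAt (fun q => S.contactForm (x q) (v q)) s q₀ := by
  have h1 := ContinuousWithinAt.mfderiv_apply (S.φ_smooth.of_le (by simp))
    (ContinuousWithinAt.J_bundle S.preservesSmoothFields h)
  show ContinuousWithinAt (fun q => -(S.dφ (x q) (S.J (x q) (v q)))) s q₀
  exact h1.neg

end SteinStructure

/-! ### `d^ℂφ` is a smooth 1-form -/

omit [CompactSpace W] in
/-- **The chart formula for `d^ℂφ`.**  For `y` in the target of the chart `c` at `x₀`, with
`z = c⁻¹ y`: `(d^ℂφ).inChart x₀ y (V) = D(φ ∘ c⁻¹)_y (Ĵ_z (V 0))`, `Ĵ_z = JTriv J x₀ z` the matrix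
of `J` in the trivialization at `x₀` (the derivative of `c⁻¹` at `y` *is* the inverse fibre map
of that trivialization, `TangentBundle.symmL_trivializationAt_eq_core`). [folklore] -/
theorem inChart_dComplex_apply {J : (x : W) → (E4 →L[ℝ] E4)} {φ : W → ℝ}
    (hφ : ContMDiff (𝓡∂ 4) 𝓘(ℝ, ℝ) ∞ φ) (x₀ : W) {y : E4}
    (hy : y ∈ (extChartAt (𝓡∂ 4) x₀).target) (V : Fin 1 → E4) :
    (dComplex J φ).inChart x₀ y V =
      fderivWithin ℝ (φ ∘ (extChartAt (𝓡∂ 4) x₀).symm) (extChartAt (𝓡∂ 4) x₀).target y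
        (JTriv J x₀ ((extChartAt (𝓡∂ 4) x₀).symm y) (V 0)) := by
  set c := extChartAt (𝓡∂ 4) x₀ with hc
  set z := c.symm y with hz
  set e := trivializationAt E4 (TangentSpace (𝓡∂ 4)) x₀ with he
  have hzs : z ∈ (chartAt (EuclideanHalfSpace 4) x₀).source := by
    rw [← extChartAt_source (𝓡∂ 4)]; exact c.map_target hy
  have hyI : y ∈ range (𝓡∂ 4) := extChartAt_target_subset_range x₀ hy
  -- the derivative of `c⁻¹` at `y` is the inverse fibre map of the trivialization at `x₀`
  have hLeq : (mfderivWithin 𝓘(ℝ, E4) (𝓡∂ 4) c.symm (range (𝓡∂ 4)) y : E4 →L[ℝ] E4) =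
      e.symmL ℝ z := by
    have h1 : (mfderivWithin 𝓘(ℝ, E4) (𝓡∂ 4) c.symm (range (𝓡∂ 4)) y : E4 →L[ℝ] E4) =
        tangentCoordChange (𝓡∂ 4) x₀ z z :=
      mfderivWithin_extChartAt_symm_eq_tangentCoordChange hy
    have h2 : (e.symmL ℝ z : E4 →L[ℝ] E4) = tangentCoordChange (𝓡∂ 4) x₀ z z :=
      TangentBundle.symmL_trivializationAt_eq_core hzs
    exact h1.trans h2.symm
  have hL : ∀ u : E4, (mfderivWithin 𝓘(ℝ, E4) (𝓡∂ 4) c.symm (range (𝓡∂ 4)) y : E4 →L[ℝ] E4) u =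
      e.symmL ℝ z u := fun u => DFunLike.congr_fun hLeq u
  -- `J` in the trivialization
  have hJ : ∀ u : E4, J z (e.symmL ℝ z u) = e.symmL ℝ z (JTriv J x₀ z u) := fun u =>
    (e.symmL_continuousLinearMapAt hzs _).symm
  -- chain rule for `φ ∘ c⁻¹`
  have hchain : ∀ u : E4, mfderiv (𝓡∂ 4) 𝓘(ℝ, ℝ) φ z
      ((mfderivWithin 𝓘(ℝ, E4) (𝓡∂ 4) c.symm (range (𝓡∂ 4)) y : E4 →L[ℝ] E4) u) =
      fderivWithin ℝ (φ ∘ c.symm) c.target y u := fun u => by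
    have hg : MDifferentiableAt (𝓡∂ 4) 𝓘(ℝ, ℝ) φ (c.symm y) :=
      hφ.mdifferentiableAt (by simp)
    have hf : MDifferentiableWithinAt 𝓘(ℝ, E4) (𝓡∂ 4) c.symm (range (𝓡∂ 4)) y :=
      mdifferentiableWithinAt_extChartAt_symm hy
    have hu : UniqueMDiffWithinAt 𝓘(ℝ, E4) (range (𝓡∂ 4)) y :=
      (uniqueMDiffWithinAt_iff_uniqueDiffWithinAt).2 ((𝓡∂ 4).uniqueDiffOn _ hyI)
    have h := mfderiv_comp_mfderivWithin y hg hf hu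
    have h' : (mfderivWithin 𝓘(ℝ, E4) 𝓘(ℝ, ℝ) (φ ∘ c.symm) (range (𝓡∂ 4)) y : E4 →L[ℝ] ℝ) u =
        mfderiv (𝓡∂ 4) 𝓘(ℝ, ℝ) φ z
          ((mfderivWithin 𝓘(ℝ, E4) (𝓡∂ 4) c.symm (range (𝓡∂ 4)) y : E4 →L[ℝ] E4) u) := by
      rw [h]; rfl
    -- `c.target = range I ∩ (open set)`, so the two `fderivWithin` agree at `y`
    have ht : c.target = range (𝓡∂ 4) ∩ (𝓡∂ 4).symm ⁻¹' (chartAt (EuclideanHalfSpace 4) x₀).target := by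
      rw [hc, extChartAt_target, inter_comm]
    have hy2 : y ∈ (𝓡∂ 4).symm ⁻¹' (chartAt (EuclideanHalfSpace 4) x₀).target := by
      have : y ∈ c.target := hy
      rw [ht] at this
      exact this.2
    have hopen : IsOpen ((𝓡∂ 4).symm ⁻¹' (chartAt (EuclideanHalfSpace 4) x₀).target) :=
      (chartAt (EuclideanHalfSpace 4) x₀).open_target.preimage (𝓡∂ 4).continuous_symm
    have key : fderivWithin ℝ (φ ∘ c.symm) c.target y =
        fderivWithin ℝ (φ ∘ c.symm) (range (𝓡∂ 4)) y := by
      rw [ht, fderivWithin_inter (hopen.mem_nhds hy2)]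
    rw [← h', mfderivWithin_eq_fderivWithin]
    exact DFunLike.congr_fun key.symm u
  -- assemble
  rw [MForm.inChart_apply, dComplex_apply]
  show mfderiv (𝓡∂ 4) 𝓘(ℝ, ℝ) φ z (J z ((mfderivWithin 𝓘(ℝ, E4) (𝓡∂ 4) c.symm (range (𝓡∂ 4)) y :
    E4 →L[ℝ] E4) (V 0))) = _
  rw [hL, hJ, ← hL, hchain]

omit [CompactSpace W] in
/-- **`d^ℂφ = dφ ∘ J` is a smooth 1-form** for `φ` smooth and `J` preserving smooth vector
fields: by `inChart_dComplex_apply` its chart representative at `x₀` is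
`y ↦ D(φ ∘ c⁻¹)_y ∘ Ĵ_{c⁻¹ y}` (as a `1`-form via `ContinuousAlternatingMap.ofSubsingleton`),
`C^∞` on the chart target since `φ ∘ c⁻¹` is (`ContDiffOn.fderivWithin`) and the matrix
entries of `Ĵ` are (`contMDiffAt_JTriv`, `contDiffOn_clm_apply`). [folklore] -/
theorem isSmoothForm_dComplex_of_preservesSmoothFields [T2Space W] {J : (x : W) → (E4 →L[ℝ] E4)}
    (hJ : PreservesSmoothFields J) {φ : W → ℝ} (hφ : ContMDiff (𝓡∂ 4) 𝓘(ℝ, ℝ) ∞ φ) :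
    IsSmoothForm (dComplex J φ) := by
  intro x₀
  set c := extChartAt (𝓡∂ 4) x₀ with hc
  -- the ingredients of the chart representative
  set G : E4 → (E4 →L[ℝ] ℝ) := fun y => fderivWithin ℝ (φ ∘ c.symm) c.target y with hG
  set JT : E4 → (E4 →L[ℝ] E4) := fun y => JTriv J x₀ (c.symm y) with hJT
  have hφT : ContDiffOn ℝ ∞ (φ ∘ c.symm) c.target :=
    contMDiffOn_iff_contDiffOn.1 (hφ.comp_contMDiffOn (contMDiffOn_extChartAt_symm x₀))
  have hGs : ContDiffOn ℝ ∞ G c.target :=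
    hφT.fderivWithin (uniqueDiffOn_extChartAt_target x₀) (by simp)
  have hJTs : ∀ w : E4, ContDiffOn ℝ ∞ (fun y => JT y w) c.target := fun w => by
    have h1 : ContMDiffOn (𝓡∂ 4) 𝓘(ℝ, E4) ∞ (fun x => JTriv J x₀ x w)
        (chartAt (EuclideanHalfSpace 4) x₀).source := fun x hx =>
      (contMDiffAt_JTriv hJ x₀ w hx).contMDiffWithinAt
    have h2 : ContMDiffOn 𝓘(ℝ, E4) 𝓘(ℝ, E4) ∞ (fun y => JTriv J x₀ (c.symm y) w) c.target :=
      h1.comp (contMDiffOn_extChartAt_symm x₀) fun y hy => by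
        rw [← extChartAt_source (𝓡∂ 4)]; exact c.map_target hy
    exact contMDiffOn_iff_contDiffOn.1 h2
  have hcomp : ContDiffOn ℝ ∞ (fun y => (G y).comp (JT y)) c.target := by
    refine contDiffOn_clm_apply.2 fun w => ?_
    simp only [ContinuousLinearMap.comp_apply]
    exact hGs.clm_apply (hJTs w)
  -- the representative as a `1`-form
  set L := ContinuousAlternatingMap.ofSubsingletonLIE (𝕜 := ℝ) (E := E4) (F := ℝ) (ι := Fin 1) 0
    with hLdef
  have hR : ContDiffOn ℝ ∞ (fun y => L ((G y).comp (JT y))) c.target :=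
    L.toContinuousLinearEquiv.contDiff.comp_contDiffOn hcomp
  -- it agrees with the chart representative on the target
  have heq : ∀ y ∈ c.target, (dComplex J φ).inChart x₀ y = L ((G y).comp (JT y)) := by
    intro y hy
    ext V
    rw [inChart_dComplex_apply hφ x₀ hy V]
    rfl
  -- conclude at the centre of the chart
  have hT : c.target ∈ 𝓝[range (𝓡∂ 4)] c x₀ := extChartAt_target_mem_nhdsWithin x₀
  have hR0 : ContDiffWithinAt ℝ ∞ (fun y => L ((G y).comp (JT y))) (range (𝓡∂ 4)) (c x₀) :=
    (hR _ (mem_extChartAt_target x₀)).mono_of_mem_nhdsWithin hT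
  exact hR0.congr_of_eventuallyEq (eventually_of_mem hT heq) (heq _ (mem_extChartAt_target x₀))

namespace SteinStructure

variable [T2Space W]

/-- `d^ℂφ` of a Stein structure is a smooth 1-form. [folklore] -/
theorem isSmoothForm_dComplex (S : SteinStructure W) : IsSmoothForm (dComplex S.J S.φ) :=
  isSmoothForm_dComplex_of_preservesSmoothFields S.preservesSmoothFields S.φ_smooth

/-- **The Liouville form `λ = -d^ℂφ` of a Stein structure** is a smooth 1-form. [folklore] -/
theorem isSmoothForm_liouvilleForm (S : SteinStructure W) : IsSmoothForm (-dComplex S.J S.φ) := by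
  have h := S.isSmoothForm_dComplex.smul (-1)
  rwa [neg_one_smul] at h

/-- **The Kähler form `ω = -dd^ℂφ` is a smooth 2-form** (`isSmoothForm_mextDeriv` fed with
the discharged chart-independence fact `inChart_mextDeriv_holds`). [folklore] -/
theorem isSmoothForm_kahler (S : SteinStructure W) :
    IsSmoothForm (mextDeriv (dComplex S.J S.φ)) :=
  isSmoothForm_mextDeriv (inChart_mextDeriv_holds (𝓡∂ 4) W ℝ) S.isSmoothForm_dComplex

omit [T2Space W] in
/-- `d(-d^ℂφ)(v, w) = ω(v, w)` (`kahlerForm`). [folklore] -/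
theorem mextDeriv_liouvilleForm_apply (S : SteinStructure W) (x : W) (v w : E4) :
    mextDeriv (-dComplex S.J S.φ) x ![v, w] = S.kahlerForm x v w := by
  have h : (-dComplex S.J S.φ) = (-1 : ℝ) • dComplex S.J S.φ := (neg_one_smul ℝ _).symm
  rw [h, mextDeriv_smul]
  simp [kahlerForm]

omit [T2Space W] in
/-- `(-d^ℂφ)_x(w) = α_x(w)` (the contact form `contactForm`). [folklore] -/
theorem liouvilleForm_apply (S : SteinStructure W) (x : W) (w : E4) :
    (-dComplex S.J S.φ) x ![w] = S.contactForm x w :=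
  rfl

omit [T2Space W] in
/-- **`dφ_x` is a negative multiple of the inward coordinate at a boundary point**:
`dφ_x(v) = (v 0) · dφ_x(e₀)` with `dφ_x(e₀) < 0` (`e₀` the inward unit vector of the boundary
chart: `φ` attains its maximum on `∂W`, so the one-sided derivative inward is `≤ 0`, and
`dφ_x ≠ 0` while it vanishes on `T∂W`). [folklore] -/
theorem dφ_apply_eq_mul_of_isBoundaryPoint (S : SteinStructure W) {x : W}
    (hx : (𝓡∂ 4).IsBoundaryPoint x) (v : E4) :
    S.dφ x v = v 0 * S.dφ x (EuclideanSpace.single 0 1) ∧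
      S.dφ x (EuclideanSpace.single 0 1) < 0 := by
  set e₀ : E4 := EuclideanSpace.single 0 1 with he₀
  have hdec : S.dφ x v = v 0 * S.dφ x e₀ := by
    have hw : (v - v 0 • e₀) 0 = 0 := by simp [he₀]
    have h0 := S.mfderiv_φ_apply_eq_zero hx hw
    rw [map_sub, map_smul, sub_eq_zero] at h0
    rw [h0, smul_eq_mul]
  refine ⟨hdec, ?_⟩
  -- one-sided Fermat: `dφ_x(e₀) ≤ 0`
  have hle : S.dφ x e₀ ≤ 0 := by
    have hd : MDifferentiableAt (𝓡∂ 4) 𝓘(ℝ, ℝ) S.φ x := S.φ_smooth.mdifferentiableAt (by simp)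
    rw [dφ, mfderiv, if_pos hd]
    set g : E4 → ℝ := writtenInExtChartAt (𝓡∂ 4) 𝓘(ℝ, ℝ) x S.φ with hg
    set y₀ : E4 := extChartAt (𝓡∂ 4) x x with hy₀
    have hmax : IsLocalMaxOn g (range (𝓡∂ 4)) y₀ := by
      filter_upwards [extChartAt_target_mem_nhdsWithin (I := 𝓡∂ 4) x] with y hy
      have h1 : g y = S.φ ((extChartAt (𝓡∂ 4) x).symm y) := by
        simp only [hg, writtenInExtChartAt, Function.comp_apply, extChartAt_model_space_eq_id,
          PartialEquiv.refl_coe, id_eq]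
      have h2 : g y₀ = S.φ x := by
        simp only [hg, hy₀, writtenInExtChartAt, Function.comp_apply, extChartAt_model_space_eq_id,
          PartialEquiv.refl_coe, id_eq, extChartAt_to_inv]
      rw [h1, h2]
      exact S.φ_le_of_isBoundaryPoint hx _
    have hconv : Convex ℝ (range (𝓡∂ 4)) := by
      rw [range_modelWithCornersEuclideanHalfSpace]
      exact (convex_Ici (0 : ℝ)).linear_preimage
        ((EuclideanSpace.proj (0 : Fin 4) : E4 →L[ℝ] ℝ).toLinearMap)
    have hmem : e₀ ∈ posTangentConeAt (range (𝓡∂ 4)) y₀ := by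
      apply mem_posTangentConeAt_of_segment_subset
      apply hconv.segment_subset (mem_range_self _)
      rw [range_modelWithCornersEuclideanHalfSpace]
      show (0 : ℝ) ≤ (y₀ + e₀) 0
      have hy : (0 : ℝ) ≤ y₀ 0 := by
        have : y₀ ∈ range (𝓡∂ 4) := mem_range_self _
        rw [range_modelWithCornersEuclideanHalfSpace] at this
        exact this
      rw [PiLp.add_apply]
      have : e₀ 0 = 1 := by simp [he₀]
      rw [this]; linarith
    exact hmax.fderivWithin_nonpos hmem
  -- and `dφ_x(e₀) ≠ 0`, else `dφ_x = 0`
  have hne : S.dφ x e₀ ≠ 0 := by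
    intro h0
    apply S.regular x hx
    have key : ∀ w : E4, S.dφ x w = 0 := fun w => by
      have hw : (w - w 0 • e₀) 0 = 0 := by simp [he₀]
      have h1 := S.mfderiv_φ_apply_eq_zero hx hw
      rwa [map_sub, map_smul, h0, smul_zero, sub_zero] at h1
    exact ContinuousLinearMap.ext key
  exact lt_of_le_of_ne hle hne

/-- **A Stein domain is a Liouville domain** for the Liouville form `λ = -d^ℂφ = -dφ ∘ J`
("from Stein to Weinstein"): `λ` is smooth (`isSmoothForm_liouvilleForm`); `dλ = ω` is
non-degenerate because `ω(v, Jv) > 0` for `v ≠ 0` (`J`-convexity); and the Liouville field `Z`,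
`ι_Z ω = λ`, points transversally out of `W` along `∂W`: from `ω(Z, w) = λ(w) = α(w)` with
`w = JZ` one gets `dφ(Z) = ω(Z, JZ) > 0` (`Z ≠ 0` since `λ_x ≠ 0` at boundary points), and
`dφ_x = c · (v ↦ v 0)` with `c < 0` there (`dφ_apply_eq_mul_of_isBoundaryPoint`), so `Z 0 < 0`,
which is "outward" in the boundary chart. [cite: CieliebakEliashberg2012, §11.1] -/
theorem isLiouvilleDomain (S : SteinStructure W) : IsLiouvilleDomain W (-dComplex S.J S.φ) where
  smooth := S.isSmoothForm_liouvilleForm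
  nondegenerate x v hv := by
    by_contra hne
    have h := hv (S.J x v)
    rw [S.mextDeriv_liouvilleForm_apply] at h
    exact (S.kahlerForm_self_J_pos x hne).ne' h
  outward x hx v hv := by
    -- `ω(v, w) = α(w)` for all `w`
    have hω : ∀ w, S.kahlerForm x v w = S.contactForm x w := fun w => by
      rw [← S.mextDeriv_liouvilleForm_apply, ← S.liouvilleForm_apply]; exact hv w
    -- `dφ(v) = ω(v, Jv)`
    have hdφ : S.dφ x v = S.kahlerForm x v (S.J x v) := by
      rw [hω, contactForm_apply, S.J_sq, map_neg, neg_neg]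
    -- `v ≠ 0`: otherwise `α_x = 0`, i.e. `dφ_x = 0`
    have hv0 : v ≠ 0 := by
      rintro rfl
      apply S.regular x hx
      have key : ∀ w : E4, S.dφ x w = 0 := fun w => by
        have h1 := hω (S.J x (-w))
        rw [contactForm_apply, S.J_sq, neg_neg] at h1
        have h2 : S.kahlerForm x 0 (S.J x (-w)) = 0 := by
          have := S.kahlerForm_smul_left x (0 : ℝ) 0 (S.J x (-w))
          simpa using this
        rw [h2] at h1
        exact neg_eq_zero.1 h1.symm
      exact ContinuousLinearMap.ext key
    have hpos : 0 < S.dφ x v := by rw [hdφ]; exact S.kahlerForm_self_J_pos x hv0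
    obtain ⟨hmul, hneg⟩ := S.dφ_apply_eq_mul_of_isBoundaryPoint hx v
    rw [hmul] at hpos
    nlinarith

end SteinStructure

end Literature.Geometry.Symplectic

end
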